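import Mathlib
import Literature.Probability.RandomPlanarGeometry.SelfAvoidingWalk
import Literature.Probability.LatticeModels.TriangularLattice
import Mathlib.Analysis.SpecialFunctions.Sqrt
import HarnessLib.Audit
import Literature.Probability.RandomPlanarGeometry.HexSAW
import HarnessLib

/-!
# HexSAWScalingLimit — CONJECTURE (obligation of CriticalPhenomena/SAWScalingLimit)

Unproven conjecture migrated by the gate from `Literature/Probability/RandomPlanarGeometry/HexSAW.lean` (`Literature.Probability.RandomPlanarGeometry.SAW.HexSAWScalingLimit`): unproven conjectures are obligations of our
theories, not literature facts (human ruling 2026-08-15). Provenance: DuminilCopinSmirnov2012. Routes use it as a crux item or via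
`--conditional-bridge --conditional-on HexSAWScalingLimit`; a proof goes in the sibling `Theorems/HexSAWScalingLimitHolds.lean` as `theorem HexSAWScalingLimit_holds : HexSAWScalingLimit` so this file stays a conjecture LEAF that Literature/ may import.
-/

namespace Summit.CriticalPhenomena.SAWScalingLimit

open Literature Literature.Probability Literature.Probability.RandomPlanarGeometry Literature.Probability.RandomPlanarGeometry.SAW
open MeasureTheory Filter Topology Literature.Probability.LatticeModels Literature.Probability.Percolation
open scoped NNReal ENNReal

/-- OPEN CONJECTURE — **Duminil-Copin–Smirnov 2012, Conjecture 1: the critical self-avoiding walk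
on the hexagonal lattice converges to chordal SLE_{8/3}**, posed in H. Duminil-Copin, S. Smirnov,
*The connective constant of the honeycomb lattice equals `√(2+√2)`*, Ann. of Math. 175 (2012)
1653–1665, §4 "Conjectures", Conjecture 1 (= arXiv:1007.0575, p. 9), after Lawler–Schramm–Werner,
*On the scaling limit of planar self-avoiding walk*, Proc. Sympos. Pure Math. 72 (2004), §1 and
§3.4 (existence + conformal covariance of the scaling limit ⇒ SLE_{8/3}) [status: open]:
"Let `Ω` be a simply connected domain (not equal to `ℂ`) with two distinct points `a, b` on its
boundary. For `x = x_c`, the law of `γ_δ` in `(Ω_δ, a_δ, b_δ)` converges when `δ → 0` to the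
(chordal) Schramm–Loewner Evolution with parameter `κ = 8/3` in `Ω` from `a` to `b`." Stated for
bounded Jordan domains with two marked prime ends (`DobrushinDomain`), every endpoint
approximation (`IsEmbEndpointApprox`), the law `hexSAWLaw` pushed to curves modulo
reparametrisation, and the library's convergence in law to chordal SLE (`ConvergesInLawToSLE`);
the `δℤ²` analogue is `SAWScalingLimit`.
Status (re-verified 2026-08-15): open. The source proves only Theorem 1 (`μ = √(2+√2)`,
`DuminilCopinSmirnov2012_thm1`) and writes (p. 10) that proving its Conjecture 2 (conformal
covariance of the parafermionic observable) "would be a major step toward Conjecture 1"; the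
obstruction — the observable satisfies only half of the discrete Cauchy–Riemann relations — is the
tree's barrier `Literature.Barriers.CriticalPhenomena.ParafermionicHalfCauchyRiemann`; the 2023
literature still calls the planar SAW scaling limit "conjectural" (Krachun–Panagiotis,
arXiv:2310.17299, p. 3). A registered open statement (CONVENTIONS §4), not a named fact: no
`HexSAWScalingLimit_holds` is to be expected; users take `(h : HexSAWScalingLimit)` (route
`SAWHexUniversality`, `HexConjecture`). Name kept (it has users, see the module docstring
"Registry"). [cite: DuminilCopinSmirnov2012, §4 Conjecture 1] -/
@[conjecture] def HexSAWScalingLimit : Prop :=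
  ∀ (D : DobrushinDomain) (a b : ℝ → HexVertex), IsEmbEndpointApprox hexGraph hexCenter D a b →
    ConvergesInLawToSLE ((8 : ℝ≥0) / 3) D
      (fun δ (γ : HexDomainSAW D.carrier δ (a δ) (b δ)) => γ.curve)
      (fun δ => hexSAWLaw D.carrier δ (a δ) (b δ))

/-! ### API -/

end Summit.CriticalPhenomena.SAWScalingLimit
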